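import Literature.Claims.NS.Magsanop2026
import HarnessLib

/-!
# C145 `Magsanop2026` — the abstract Grönwall step p.3 l.21 (`Step_L22_gronwall`) is false as typed

Cell `ns-claims` (D-0090), claim skeleton `Literature/Claims/NS/Magsanop2026.lean` (typist-9 lineage).
Object offered by ns-claims-lit-3 g9 to the refuter of record lineage (refuter-4; REFUTER.md row
«`Step_L22_gronwall` … SUSPICIOUS — scalar spike (g ≡ n on [0,1/n), y = y₀e^{Kn²t}) kills it; kit v2
candidate»). RECORDS-GRADE: the located head of #132 is `Step_Thm2` (`not_Step_Thm2`, p526868); this step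
sits LATER in print order and is not reached.

THE TYPED FACE (`Step_L22_gronwall`, skeleton l.239–245): for all `K, I, y₀ ≥ 0` there is ONE bound `B` such
that every continuous `y ≥ 0` on `[0,T)` with `y(0) ≤ y₀` and `y′ ≤ K·g²·y` on `(0,T)`, for ANY `g ≥ 0`
integrable on `[0,T)` with `∫₀ᵀ g ≤ I`, satisfies `y ≤ B` on `[0,T)`.

THE DEFECT: Grönwall needs `∫ g²`, and `∫ g ≤ I` does not bound `∫ g²`. SPIKE WITNESS at `K = I = y₀ = 1`:
for `h > 0` take `T = 1/h`, `g ≡ h` (so `∫_{[0,T)} g = 1`) and `y(t) = exp(h²t)` (so `y′ = h²y = K·g²·y`,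
`y(0) = 1`); then `y(T/2) = exp(h/2) > h/2`, unbounded in `h`. Given the purported `B`, `h = 2(|B| + 1)` gives
`y(T/2) > |B| + 1 > B`.

[cite: Magsanop2026, §3 p.3 l.17–21 «Since ∫₀^∞‖∇u‖²dt = E(0)/ν < ∞, Gronwall implies ‖ω(t)‖_{L²} ≤ C(E₀,ν)»]

WHAT THIS IS NOT: not a claim about NS regularity or blow-up; not a claim about any author beyond the typed
locator.
-/

set_option linter.dupNamespace false

noncomputable section

open Set MeasureTheory Real

namespace Summit.NavierStokesRegularity.NavierStokesRegularity.Theorems.Magsanop2026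

open Literature.Claims.NS.Magsanop2026

/-- The spike profile: `y_h(t) = exp(h²·t)` solves `y′ = h²·y`. -/
theorem hasDerivAt_spike (h t : ℝ) :
    HasDerivAt (fun s => exp (h ^ 2 * s)) (h ^ 2 * exp (h ^ 2 * t)) t := by
  have h1 : HasDerivAt (fun s => h ^ 2 * s) (h ^ 2) t := by
    simpa using (hasDerivAt_id t).const_mul (h ^ 2)
  have h2 := h1.exp
  simpa [mul_comm] using h2

/-- **`Step_L22_gronwall` is false as typed** (spike witness at `K = I = y₀ = 1`).
[cite: Magsanop2026, §3 p.3 l.17–21] -/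
theorem not_Step_L22_gronwall : ¬ Step_L22_gronwall := by
  intro hG
  obtain ⟨B, hB⟩ := hG 1 1 1 zero_le_one zero_le_one zero_le_one
  -- spike height and lifespan
  set h : ℝ := 2 * (|B| + 1) with hh
  have hpos : 0 < h := by rw [hh]; positivity
  set T : ℝ := 1 / h with hT
  have hTpos : 0 < T := by rw [hT]; positivity
  -- the witness pair
  have key := hB T (fun s => exp (h ^ 2 * s)) (fun _ => h)
    (by fun_prop)
    (fun t _ => ⟨(hasDerivAt_spike h t).differentiableAt, by
      rw [(hasDerivAt_spike h t).deriv]; ring_nf; exact le_rfl⟩)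
    (fun t _ => (exp_pos _).le) (by simp) (fun _ => hpos.le)
    (by exact integrableOn_const (by rw [Real.volume_Ico]; exact ENNReal.ofReal_lt_top |>.ne))
    (by
      rw [setIntegral_const, Real.volume_real_Ico_of_le hTpos.le, smul_eq_mul, sub_zero, hT, one_div,
        inv_mul_cancel₀ hpos.ne'])
    (T / 2) ⟨by positivity, by linarith⟩
  -- `y(T/2) = exp(h/2) > h/2 = |B| + 1 > B`
  have hval : h ^ 2 * (T / 2) = h / 2 := by
    rw [hT]; field_simp
  rw [hval] at key
  have hgt : h / 2 < exp (h / 2) := by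
    have := add_one_lt_exp (x := h / 2) (by positivity)
    linarith
  have hB' : B < h / 2 := by
    rw [hh]; have := le_abs_self B; linarith
  linarith

end Summit.NavierStokesRegularity.NavierStokesRegularity.Theorems.Magsanop2026

end
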